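import Summits.CriticalPhenomena.PercolationContinuityZ3.Theorems.Transplant.GrigorchukPowerNcHaraSladeLaceDefs
import Mathlib.Analysis.InnerProductSpace.l2Space
import Mathlib.Analysis.InnerProductSpace.Adjoint
import Mathlib.Analysis.Normed.Ring.InfiniteSum
import HarnessLib

/-!
# W4 S3b-α «LaceOperators» (first file): the ℓ²-packaging of left-invariant kernels on `𝔊^k` — `toL2`, the right shifts `ρ(x)`, the kernel operator `ρ(a) = Σ_g a(g) ρ(g)`

Definition + proof file (`--kind definition`, `--supports stmt-CriticalPhenomena-4575 --as helper`), lane `prim-bschramm`, seat `prim-bschramm-gen-1` gen 13 (GEN pen);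
item α of the director's S3b WORD (#10178) / lead allocation :588 (GEN lineage, after the door port), design text P3-NILPOTENT §38 (p3 g43; def-list d1–d7, lemmas L1–L5);
this is α₁ = (d1) `toL2`, (d2) `rightShift`/`rhoL`, the coordinate functional `evalL2`, (d4) `kernelOp` with its API: operator-norm bound `‖ρ(a)‖ ≤ ‖a‖₁` (no Schur
test: the `tsum` converges in OPERATOR NORM), the pointwise formula `(ρ(a)η)(y) = Σ_g a(g) η(yg)`, `ρ(δ) = 1`, linearity, the PRODUCT LAW `ρ(a) ρ(b) = ρ(a ⋆ b)` with
DEFS-C's convolution `(a ⋆ b)(g) = Σ_y a(y) b(y⁻¹g)` (inlined, no second convention), and the ADJOINT `ρ(a)† = ρ(ǎ)`, `ǎ(g) = a(g⁻¹)`; (d5) `adjOp`/`srwOp`/`lazyOp`.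
Serves S3b′ `stub_fBoot_le_of_laceBound` (W4 skeleton v1.8 :80) via P3-NILPOTENT §37.2; ASSERTS NOTHING about it (no inverse, no Neumann series, no `laceBound`,
no OIRB here).  builds on p205010 (kernel theorem, internal audit signed; external expert review pending) — nothing here uses p205010.  No instance, no notation, no
sorry; real scalars; every def total.
[cite: HeydenreichVanDerHofstad2017, §6.2 (convolution identity), Lemma 8.11–8.12] [cite: HaraSlade1990, §4 (the lace expansion as an operator identity)]
-/

noncomputable section

namespace Summit.CriticalPhenomena.PercolationContinuityZ3.Theorems.Transplant

namespace Grigorchuk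

namespace NcHaraSlade

open SimpleGraph Literature.Probability.Percolation
open scoped ENNReal Classical InnerProductSpace

variable {k : ℕ}

/-! ## §1 (d1) Finitely supported test vectors inside `ℓ²(𝔊^k, ℝ)` -/

/-- A finitely supported function is square-summable. [folklore] -/
theorem memℓp_two_of_finsupp (ξ : GPow k →₀ ℝ) : Memℓp (fun y : GPow k => ξ y) 2 := by
  refine memℓp_gen ?_
  exact summable_of_ne_finset_zero (s := ξ.support) fun y hy => by
    have : ξ y = 0 := Finsupp.notMem_support_iff.1 hy
    simp [this]

/-- **(d1) `toL2 ξ`** — the finitely supported test vector `ξ` (DEFS-A/B/C currency) as an element of `ℓ²(𝔊^k, ℝ)`; `(toL2 ξ) y = ξ y`.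
[cite: HeydenreichVanDerHofstad2017, §1.2 (test functions)] -/
def toL2 (ξ : GPow k →₀ ℝ) : lp (fun _ : GPow k => ℝ) 2 := ⟨fun y => ξ y, memℓp_two_of_finsupp ξ⟩

/-- `(toL2 ξ) y = ξ y`. [folklore] -/
@[simp] theorem toL2_apply (ξ : GPow k →₀ ℝ) (y : GPow k) : toL2 ξ y = ξ y := rfl

/-! ## §2 The coordinate functionals and (d2) the right shifts -/

/-- The coordinate functional `η ↦ η y` on `ℓ²` (bounded by `‖η‖`). [folklore] -/
def evalL2 (y : GPow k) : lp (fun _ : GPow k => ℝ) 2 →L[ℝ] ℝ :=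
  LinearMap.mkContinuous { toFun := fun η => η y, map_add' := fun _ _ => rfl, map_smul' := fun _ _ => rfl } 1
    fun η => by rw [one_mul]; exact lp.norm_apply_le_norm (by norm_num) η y

/-- `evalL2 y η = η y`. [folklore] -/
@[simp] theorem evalL2_apply (y : GPow k) (η : lp (fun _ : GPow k => ℝ) 2) : evalL2 y η = η y := rfl

/-- Precomposition with a bijection of `𝔊^k` preserves square-summability. [folklore] -/
theorem memℓp_comp_equiv (η : lp (fun _ : GPow k => ℝ) 2) (e : GPow k ≃ GPow k) : Memℓp (fun y : GPow k => η (e y)) 2 := by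
  have hη := lp.memℓp η
  rw [memℓp_gen_iff (by norm_num)] at hη ⊢
  exact (e.summable_iff (f := fun y : GPow k => ‖η y‖ ^ (2 : ℝ≥0∞).toReal)).2 hη

/-- The right shift as a linear map: `(ρ(x)η)(y) = η(y·x)`. [cite: HeydenreichVanDerHofstad2017, §6.2] -/
def rightShiftLM (x : GPow k) : lp (fun _ : GPow k => ℝ) 2 →ₗ[ℝ] lp (fun _ : GPow k => ℝ) 2 where
  toFun η := ⟨fun y => η (y * x), memℓp_comp_equiv η (Equiv.mulRight x)⟩
  map_add' _ _ := rfl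
  map_smul' _ _ := rfl

/-- `(rightShiftLM x η) y = η (y * x)`. [folklore] -/
@[simp] theorem rightShiftLM_apply (x : GPow k) (η : lp (fun _ : GPow k => ℝ) 2) (y : GPow k) : rightShiftLM x η y = η (y * x) := rfl

/-- The right shift preserves the `ℓ²` norm (reindexing `y ↦ y·x`). [folklore] -/
theorem norm_rightShiftLM (x : GPow k) (η : lp (fun _ : GPow k => ℝ) 2) : ‖rightShiftLM x η‖ = ‖η‖ := by
  rw [lp.norm_eq_tsum_rpow (by norm_num), lp.norm_eq_tsum_rpow (by norm_num)]
  congr 1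
  exact (Equiv.mulRight x).tsum_eq (fun y => ‖η y‖ ^ (2 : ℝ≥0∞).toReal)

/-- **(d2) `rightShift x : ℓ² ≃ₗᵢ[ℝ] ℓ²`**, `(ρ(x)η)(y) = η(y·x)`, inverse `ρ(x⁻¹)` — DEFS-C's `ρ`. [cite: HeydenreichVanDerHofstad2017, §6.2] -/
def rightShift (x : GPow k) : lp (fun _ : GPow k => ℝ) 2 ≃ₗᵢ[ℝ] lp (fun _ : GPow k => ℝ) 2 :=
  LinearIsometryEquiv.mk
    { rightShiftLM x with
      invFun := rightShiftLM x⁻¹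
      left_inv := fun η => by ext y; simp [mul_assoc]
      right_inv := fun η => by ext y; simp [mul_assoc] }
    (norm_rightShiftLM x)

/-- `(rightShift x η) y = η (y * x)`. [folklore] -/
@[simp] theorem rightShift_apply (x : GPow k) (η : lp (fun _ : GPow k => ℝ) 2) (y : GPow k) : rightShift x η y = η (y * x) := rfl

/-- **`ρL x : ℓ² →L[ℝ] ℓ²`**, the right shift as a bounded operator (the summand of `kernelOp`). [cite: HeydenreichVanDerHofstad2017, §6.2] -/
def rhoL (x : GPow k) : lp (fun _ : GPow k => ℝ) 2 →L[ℝ] lp (fun _ : GPow k => ℝ) 2 := (rightShift x).toLinearIsometry.toContinuousLinearMap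

/-- `(rhoL x η) y = η (y * x)`. [folklore] -/
@[simp] theorem rhoL_apply (x : GPow k) (η : lp (fun _ : GPow k => ℝ) 2) (y : GPow k) : rhoL x η y = η (y * x) := rfl

/-- `‖ρL x‖ ≤ 1`. [folklore] -/
theorem norm_rhoL_le (x : GPow k) : ‖rhoL (k := k) x‖ ≤ 1 := (rightShift x).toLinearIsometry.norm_toContinuousLinearMap_le

/-- `‖ρL x η‖ = ‖η‖`. [folklore] -/
theorem norm_rhoL_apply (x : GPow k) (η : lp (fun _ : GPow k => ℝ) 2) : ‖rhoL x η‖ = ‖η‖ := norm_rightShiftLM x η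

/-- `ρ(1) = 1`. [folklore] -/
theorem rhoL_one : rhoL (1 : GPow k) = 1 := by
  ext η y
  simp

/-- **`ρ(g) ρ(h) = ρ(g h)`** (as operators: `(ρ(g)ρ(h)η)(y) = η(y g h)`). [cite: HeydenreichVanDerHofstad2017, §6.2] -/
theorem rhoL_mul (g h : GPow k) : rhoL g * rhoL h = rhoL (g * h) := by
  ext η y
  simp [mul_assoc]

/-! ## §3 (d4) The kernel operator `ρ(a) = Σ_g a(g) ρ(g)` of a summable kernel -/

/-- **(d4) `kernelOp a = Σ'_g a(g) • ρL g`** — the (left-invariant) convolution operator of a kernel `a : 𝔊^k → ℝ`, as an OPERATOR-NORM-convergent series in the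
Banach algebra `ℓ² →L[ℝ] ℓ²` (junk `0` if `a ∉ ℓ¹`; every lemma carries `Summable |a|`). [cite: HeydenreichVanDerHofstad2017, §6.2 (convolution operators)] -/
def kernelOp (a : GPow k → ℝ) : lp (fun _ : GPow k => ℝ) 2 →L[ℝ] lp (fun _ : GPow k => ℝ) 2 := ∑' g : GPow k, a g • rhoL g

/-- `‖a(g) • ρL g‖ ≤ |a(g)|`. [folklore] -/
theorem norm_smul_rhoL_le (a : GPow k → ℝ) (g : GPow k) : ‖a g • rhoL (k := k) g‖ ≤ |a g| := by
  rw [norm_smul, Real.norm_eq_abs]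
  exact mul_le_of_le_one_right (abs_nonneg _) (norm_rhoL_le g)

/-- The summands of `kernelOp a` are norm-summable for `a ∈ ℓ¹`. [folklore] -/
theorem summable_norm_smul_rhoL {a : GPow k → ℝ} (ha : Summable fun g => |a g|) : Summable fun g => ‖a g • rhoL (k := k) g‖ :=
  ha.of_nonneg_of_le (fun _ => norm_nonneg _) (norm_smul_rhoL_le a)

/-- The series defining `kernelOp a` converges (in operator norm) for `a ∈ ℓ¹`. [folklore] -/
theorem summable_smul_rhoL {a : GPow k → ℝ} (ha : Summable fun g => |a g|) : Summable fun g => a g • rhoL (k := k) g :=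
  (summable_norm_smul_rhoL ha).of_norm

/-- `HasSum (g ↦ a(g) • ρL g) (kernelOp a)`. [folklore] -/
theorem hasSum_kernelOp {a : GPow k → ℝ} (ha : Summable fun g => |a g|) : HasSum (fun g => a g • rhoL g) (kernelOp a) :=
  (summable_smul_rhoL ha).hasSum

/-- **`‖ρ(a)‖ ≤ ‖a‖₁`** (triangle inequality for the operator-norm series — no Schur test). [cite: HeydenreichVanDerHofstad2017, §6.2] -/
theorem norm_kernelOp_le {a : GPow k → ℝ} (ha : Summable fun g => |a g|) : ‖kernelOp a‖ ≤ ∑' g, |a g| :=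
  tsum_of_norm_bounded ha.hasSum (norm_smul_rhoL_le a)

/-- `ρ(a)η = Σ'_g a(g) • ρL g η` (evaluation is continuous linear). [folklore] -/
theorem kernelOp_apply {a : GPow k → ℝ} (ha : Summable fun g => |a g|) (η : lp (fun _ : GPow k => ℝ) 2) :
    kernelOp a η = ∑' g, a g • rhoL g η := by
  have h := (ContinuousLinearMap.apply ℝ (lp (fun _ : GPow k => ℝ) 2) η).map_tsum (summable_smul_rhoL ha)
  rw [kernelOp]
  simpa only [ContinuousLinearMap.apply_apply, FunLike.coe_smul, Pi.smul_apply] using h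

/-- The summands of `ρ(a)η` are summable in `ℓ²`. [folklore] -/
theorem summable_smul_rhoL_apply {a : GPow k → ℝ} (ha : Summable fun g => |a g|) (η : lp (fun _ : GPow k => ℝ) 2) :
    Summable fun g => a g • rhoL g η := by
  have h := (summable_smul_rhoL ha).mapL (ContinuousLinearMap.apply ℝ (lp (fun _ : GPow k => ℝ) 2) η)
  simpa only [ContinuousLinearMap.apply_apply, FunLike.coe_smul, Pi.smul_apply] using h

/-- **The pointwise formula `(ρ(a)η)(y) = Σ'_g a(g) η(y g)`** (`= Σ_z a(y⁻¹z) η(z)`: a LEFT-invariant kernel). [cite: HeydenreichVanDerHofstad2017, §6.2] -/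
theorem kernelOp_apply_apply {a : GPow k → ℝ} (ha : Summable fun g => |a g|) (η : lp (fun _ : GPow k => ℝ) 2) (y : GPow k) :
    kernelOp a η y = ∑' g, a g * η (y * g) := by
  rw [kernelOp_apply ha]
  have h := (evalL2 y).map_tsum (summable_smul_rhoL_apply ha η)
  simp only [evalL2_apply] at h
  rw [h]
  refine tsum_congr fun g => ?_
  rw [lp.coeFn_smul, Pi.smul_apply, rhoL_apply, smul_eq_mul]

/-- **`ρ(δ) = 1`**. [folklore] -/
theorem kernelOp_deltaFun : kernelOp (deltaFun k) = 1 := by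
  unfold kernelOp
  rw [tsum_eq_single (1 : GPow k) (fun g hg => by rw [deltaFun_of_ne_one hg, zero_smul]), deltaFun_one, one_smul, rhoL_one]

/-- `ρ(a + b) = ρ(a) + ρ(b)` on `ℓ¹`. [folklore] -/
theorem kernelOp_add {a b : GPow k → ℝ} (ha : Summable fun g => |a g|) (hb : Summable fun g => |b g|) :
    kernelOp (fun g => a g + b g) = kernelOp a + kernelOp b := by
  unfold kernelOp
  simp_rw [add_smul]
  exact (summable_smul_rhoL ha).tsum_add (summable_smul_rhoL hb)

/-- `ρ(c·a) = c·ρ(a)`. [folklore] -/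
theorem kernelOp_const_mul {a : GPow k → ℝ} (ha : Summable fun g => |a g|) (c : ℝ) :
    kernelOp (fun g => c * a g) = c • kernelOp a := by
  unfold kernelOp
  simp_rw [mul_smul]
  exact (summable_smul_rhoL ha).tsum_const_smul c

/-- **THE PRODUCT LAW `ρ(a) ρ(b) = ρ(a ⋆ b)`** for `a, b ∈ ℓ¹`, with DEFS-C's convolution `(a ⋆ b)(m) = Σ'_g a(g) b(g⁻¹m)`: the absolutely convergent double series
`Σ_{g,h} a(g)b(h) ρ(gh)` re-indexed along the shear `(g,h) ↦ (gh, g)`. [cite: HeydenreichVanDerHofstad2017, §6.2 (convolution)] -/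
theorem kernelOp_mul {a b : GPow k → ℝ} (ha : Summable fun g => |a g|) (hb : Summable fun g => |b g|) :
    kernelOp a * kernelOp b = kernelOp (fun m => ∑' g, a g * b (g⁻¹ * m)) := by
  have ha' : Summable fun g => ‖a g‖ := by simpa only [Real.norm_eq_abs] using ha
  have hb' : Summable fun g => ‖b g‖ := by simpa only [Real.norm_eq_abs] using hb
  -- the shear
  set e : GPow k × GPow k ≃ GPow k × GPow k :=
    ⟨fun z => (z.1 * z.2, z.1), fun q => (q.2, q.2⁻¹ * q.1), fun z => by simp, fun q => by simp⟩ with he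
  set Φ : GPow k × GPow k → ℝ := fun q => a q.2 * b (q.2⁻¹ * q.1) with hΦ
  have hΦe : ∀ z : GPow k × GPow k, Φ (e z) = a z.1 * b z.2 := fun z => by simp [hΦ, he]
  have hΦs : Summable Φ := by
    have h := summable_mul_of_summable_norm ha' hb'
    exact e.summable_iff.1 (by simpa only [Function.comp_def, hΦe] using h)
  have hF : Summable fun q : GPow k × GPow k => Φ q • rhoL (k := k) q.1 :=
    Summable.of_norm_bounded hΦs.abs fun q => by
      rw [norm_smul, Real.norm_eq_abs]; exact mul_le_of_le_one_right (abs_nonneg _) (norm_rhoL_le q.1)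
  unfold kernelOp
  calc (∑' g, a g • rhoL (k := k) g) * ∑' h, b h • rhoL h
      = ∑' z : GPow k × GPow k, (a z.1 • rhoL z.1) * (b z.2 • rhoL z.2) :=
        tsum_mul_tsum_of_summable_norm (summable_norm_smul_rhoL ha) (summable_norm_smul_rhoL hb)
    _ = ∑' z : GPow k × GPow k, Φ (e z) • rhoL (e z).1 := tsum_congr fun z => by rw [smul_mul_smul_comm, rhoL_mul, hΦe]; rfl
    _ = ∑' q : GPow k × GPow k, Φ q • rhoL q.1 := e.tsum_eq (fun q => Φ q • rhoL q.1)
    _ = ∑' m, ∑' g, Φ (m, g) • rhoL m := hF.tsum_prod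
    _ = ∑' m, (∑' g, Φ (m, g)) • rhoL m := tsum_congr fun m => (hΦs.prod_factor m).tsum_smul_const _
    _ = ∑' m, (∑' g, a g * b (g⁻¹ * m)) • rhoL m := rfl

/-! ## §4 Adjoints: `ρ(x)† = ρ(x⁻¹)`, `ρ(a)† = ρ(ǎ)` -/

/-- **`ρ(x)† = ρ(x⁻¹)`** (reindex `y ↦ y x⁻¹` in `⟪η, ρ(x)ζ⟫ = Σ_y η(y) ζ(yx)`). [cite: HeydenreichVanDerHofstad2017, §6.2] -/
theorem adjoint_rhoL (x : GPow k) : ContinuousLinearMap.adjoint (rhoL x) = rhoL (k := k) x⁻¹ := by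
  symm
  rw [ContinuousLinearMap.eq_adjoint_iff]
  intro η ζ
  rw [lp.inner_eq_tsum, lp.inner_eq_tsum]
  simp only [rhoL_apply]
  rw [← (Equiv.mulRight x⁻¹).tsum_eq (fun y => ⟪η y, ζ (y * x)⟫_ℝ)]
  refine tsum_congr fun y => ?_
  simp [mul_assoc]

/-- **`ρ(a)† = ρ(ǎ)`, `ǎ(g) = a(g⁻¹)`**, for `a ∈ ℓ¹` (the adjoint is a continuous additive map commuting with the operator series; `ρ(g)† = ρ(g⁻¹)`; reindex `g ↦ g⁻¹`).
[cite: HeydenreichVanDerHofstad2017, §6.2] -/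
theorem adjoint_kernelOp {a : GPow k → ℝ} (ha : Summable fun g => |a g|) :
    ContinuousLinearMap.adjoint (kernelOp a) = kernelOp (fun g => a g⁻¹) := by
  have h1 : HasSum (fun g => ContinuousLinearMap.adjoint (a g • rhoL (k := k) g)) (ContinuousLinearMap.adjoint (kernelOp a)) :=
    (hasSum_kernelOp ha).mapL ((ContinuousLinearMap.adjoint : (lp (fun _ : GPow k => ℝ) 2 →L[ℝ] lp (fun _ : GPow k => ℝ) 2) ≃ₗᵢ⋆[ℝ]
      (lp (fun _ : GPow k => ℝ) 2 →L[ℝ] lp (fun _ : GPow k => ℝ) 2)).toContinuousLinearEquiv.toContinuousLinearMap)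
  have h2 : ∀ g, ContinuousLinearMap.adjoint (a g • rhoL (k := k) g) = a g • rhoL g⁻¹ := fun g => by
    rw [map_smulₛₗ ContinuousLinearMap.adjoint, starRingEnd_apply, star_trivial, adjoint_rhoL]
  simp_rw [h2] at h1
  rw [← h1.tsum_eq]
  unfold kernelOp
  rw [← (Equiv.inv (GPow k)).tsum_eq (fun g => a g⁻¹ • rhoL (k := k) g)]
  exact tsum_congr fun g => by simp only [Equiv.inv_apply, inv_inv]

/-- **Matrix entries of `ρ(a)`**: `(ρ(a) δ_y)(x) = a(x⁻¹ y)` — a LEFT-invariant kernel. [cite: HeydenreichVanDerHofstad2017, §6.2] -/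
theorem kernelOp_single_apply {a : GPow k → ℝ} (ha : Summable fun g => |a g|) (x y : GPow k) :
    kernelOp a (lp.single 2 y (1 : ℝ)) x = a (x⁻¹ * y) := by
  rw [kernelOp_apply_apply ha, tsum_eq_single (x⁻¹ * y)]
  · simp
  · intro g hg
    have : x * g ≠ y := fun h => hg (by rw [← h, inv_mul_cancel_left])
    simp [lp.single_apply, this]

/-! ## §5 (d5) The adjacency, simple-random-walk and lazy operators of `Cay(𝔊^k; std)` -/

/-- **(d5) `adjOp k = Σ_{s ∈ S_k} ρL s`** (the adjacency operator `A = ρ(𝟙_{S_k})` of `Cay(𝔊^k; std)`). [cite: HeydenreichVanDerHofstad2017, §5.2 (random-walk quantities)] -/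
def adjOp (k : ℕ) : lp (fun _ : GPow k => ℝ) 2 →L[ℝ] lp (fun _ : GPow k => ℝ) 2 := ∑ s ∈ gkGens k, rhoL s

/-- **`srwOp k = (4k)⁻¹ • adjOp k`** (the simple-random-walk operator `P`; `0` for `k = 0`). [cite: HeydenreichVanDerHofstad2017, §5.2] -/
def srwOp (k : ℕ) : lp (fun _ : GPow k => ℝ) 2 →L[ℝ] lp (fun _ : GPow k => ℝ) 2 := (1 / (4 * (k : ℝ))) • adjOp k

/-- **`lazyOp k = ½ (1 + srwOp k)`** (the lazy operator `P_L`; `𝒢_L = (1 − P_L)⁻¹ = 2𝒢`, SN3). [cite: HeydenreichVanDerHofstad2017, §5.2] -/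
def lazyOp (k : ℕ) : lp (fun _ : GPow k => ℝ) 2 →L[ℝ] lp (fun _ : GPow k => ℝ) 2 := (1 / 2 : ℝ) • (1 + srwOp k)

/-- `(adjOp k η) y = Σ_{s ∈ S_k} η(y s)`. [folklore] -/
theorem adjOp_apply_apply (η : lp (fun _ : GPow k => ℝ) 2) (y : GPow k) : adjOp k η y = ∑ s ∈ gkGens k, η (y * s) := by
  simp only [adjOp, FunLike.coe_sum, Finset.sum_apply, lp.coeFn_sum, rhoL_apply]

/-- The standard generators are involutions: `s⁻¹ = s`. [cite: Grigorchuk1980, a² = b² = c² = d² = 1] -/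
theorem inv_eq_self_of_mem_gkGens {s : GPow k} (hs : s ∈ gkGens k) : s⁻¹ = s := by
  rw [gkGens_eq_image, Finset.mem_image] at hs
  obtain ⟨⟨i, y⟩, -, rfl⟩ := hs
  rw [← Pi.mulSingle_inv, toG_inv]

/-- **`A† = A`** (every generator is an involution). [folklore] -/
theorem adjoint_adjOp : ContinuousLinearMap.adjoint (adjOp k) = adjOp k := by
  unfold adjOp
  rw [map_sum]
  refine Finset.sum_congr rfl fun s hs => ?_
  rw [adjoint_rhoL, inv_eq_self_of_mem_gkGens hs]

/-- `‖A‖ ≤ 4k`. [folklore] -/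
theorem norm_adjOp_le : ‖adjOp k‖ ≤ 4 * k := by
  unfold adjOp
  calc ‖∑ s ∈ gkGens k, rhoL (k := k) s‖ ≤ ∑ s ∈ gkGens k, ‖rhoL (k := k) s‖ := norm_sum_le _ _
    _ ≤ ∑ _s ∈ gkGens k, (1 : ℝ) := Finset.sum_le_sum fun s _ => norm_rhoL_le s
    _ = 4 * k := by rw [Finset.sum_const, card_gkGens, nsmul_eq_mul, mul_one]; push_cast; ring

/-- **`‖P‖ ≤ 1`** for `k ≥ 1`. [cite: HeydenreichVanDerHofstad2017, §5.2] -/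
theorem norm_srwOp_le (hk : 1 ≤ k) : ‖srwOp k‖ ≤ 1 := by
  have h1 : (1 : ℝ) ≤ k := by exact_mod_cast hk
  have hk' : (0 : ℝ) < 4 * k := by linarith
  unfold srwOp
  rw [norm_smul, Real.norm_eq_abs, abs_of_nonneg (by positivity)]
  calc 1 / (4 * (k : ℝ)) * ‖adjOp k‖ ≤ 1 / (4 * (k : ℝ)) * (4 * k) := mul_le_mul_of_nonneg_left norm_adjOp_le (by positivity)
    _ = 1 := by field_simp

/-- `P† = P`. [folklore] -/
theorem adjoint_srwOp : ContinuousLinearMap.adjoint (srwOp k) = srwOp k := by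
  unfold srwOp
  rw [map_smulₛₗ ContinuousLinearMap.adjoint, starRingEnd_apply, star_trivial, adjoint_adjOp]

/-- `P_L† = P_L`. [folklore] -/
theorem adjoint_lazyOp : ContinuousLinearMap.adjoint (lazyOp k) = lazyOp k := by
  unfold lazyOp
  rw [map_smulₛₗ ContinuousLinearMap.adjoint, starRingEnd_apply, star_trivial, map_add, adjoint_srwOp, ContinuousLinearMap.adjoint_one]

/-- `(P_L^n)† = P_L^n`. [folklore] -/
theorem adjoint_lazyOp_pow (n : ℕ) : ContinuousLinearMap.adjoint (lazyOp k ^ n) = lazyOp k ^ n := by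
  rw [← ContinuousLinearMap.star_eq_adjoint, star_pow, ContinuousLinearMap.star_eq_adjoint, adjoint_lazyOp]

/-- `|⟪η, P η⟫| ≤ ‖η‖²` for `k ≥ 1`. [folklore] -/
theorem abs_inner_srwOp_le (hk : 1 ≤ k) (η : lp (fun _ : GPow k => ℝ) 2) : |⟪η, srwOp k η⟫_ℝ| ≤ ‖η‖ ^ 2 := by
  calc |⟪η, srwOp k η⟫_ℝ| ≤ ‖η‖ * ‖srwOp k η‖ := abs_real_inner_le_norm _ _
    _ ≤ ‖η‖ * (‖srwOp k‖ * ‖η‖) := mul_le_mul_of_nonneg_left (ContinuousLinearMap.le_opNorm _ _) (norm_nonneg _)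
    _ ≤ ‖η‖ * (1 * ‖η‖) := mul_le_mul_of_nonneg_left (mul_le_mul_of_nonneg_right (norm_srwOp_le hk) (norm_nonneg _)) (norm_nonneg _)
    _ = ‖η‖ ^ 2 := by ring

/-- `⟪η, P_L η⟫ = ½ (‖η‖² + ⟪η, P η⟫)`. [folklore] -/
theorem inner_lazyOp_eq (η : lp (fun _ : GPow k => ℝ) 2) : ⟪η, lazyOp k η⟫_ℝ = (1 / 2 : ℝ) * (‖η‖ ^ 2 + ⟪η, srwOp k η⟫_ℝ) := by
  simp only [lazyOp, FunLike.coe_smul, Pi.smul_apply, add_apply, one_apply_eq_self, real_inner_smul_right,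
    inner_add_right, real_inner_self_eq_norm_sq]

/-- **`0 ≤ ⟪η, P_L η⟫`** (`P_L = ½(1 + P) ≽ 0` since `‖P‖ ≤ 1`), `k ≥ 1`. [cite: HeydenreichVanDerHofstad2017, §5.2 (laziness)] -/
theorem inner_lazyOp_nonneg (hk : 1 ≤ k) (η : lp (fun _ : GPow k => ℝ) 2) : 0 ≤ ⟪η, lazyOp k η⟫_ℝ := by
  rw [inner_lazyOp_eq]
  have h := abs_inner_srwOp_le hk η
  have h' := neg_abs_le (⟪η, srwOp k η⟫_ℝ)
  nlinarith

/-- **`⟪η, P_L η⟫ ≤ ‖η‖²`**, `k ≥ 1`. [folklore] -/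
theorem inner_lazyOp_le (hk : 1 ≤ k) (η : lp (fun _ : GPow k => ℝ) 2) : ⟪η, lazyOp k η⟫_ℝ ≤ ‖η‖ ^ 2 := by
  rw [inner_lazyOp_eq]
  have h := abs_inner_srwOp_le hk η
  have h' := le_abs_self (⟪η, srwOp k η⟫_ℝ)
  nlinarith

/-- **`0 ≤ ⟪η, P_L^n η⟫` for every `n`** (`P_L^{2m} = (P_L^m)† P_L^m`, `P_L^{2m+1} = (P_L^m)† P_L P_L^m`) — the operator form of «each `lazyStep n` is positive
semidefinite» (critic P-37-b). [cite: HeydenreichVanDerHofstad2017, §5.2] -/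
theorem inner_lazyOp_pow_nonneg (hk : 1 ≤ k) (n : ℕ) (η : lp (fun _ : GPow k => ℝ) 2) : 0 ≤ ⟪η, (lazyOp k ^ n) η⟫_ℝ := by
  rcases Nat.even_or_odd n with ⟨m, rfl⟩ | ⟨m, rfl⟩
  · rw [pow_add, mul_apply_eq_comp, ← adjoint_lazyOp_pow m, ContinuousLinearMap.adjoint_inner_right,
      adjoint_lazyOp_pow, real_inner_self_eq_norm_sq]
    positivity
  · rw [show 2 * m + 1 = m + (1 + m) by ring, pow_add, pow_add, pow_one, mul_apply_eq_comp, mul_apply_eq_comp,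
      ← adjoint_lazyOp_pow m, ContinuousLinearMap.adjoint_inner_right, adjoint_lazyOp_pow]
    exact inner_lazyOp_nonneg hk _

end NcHaraSlade

end Grigorchuk

end Summit.CriticalPhenomena.PercolationContinuityZ3.Theorems.Transplant

end
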